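import Summits.PneNP.PneNP.Theorems.Nc03AvoidResidualCoreCandFewHeadsRung

/-!
# Route Nc03AvoidResidualCore — a BC5 rung for `CandAvoidLinearFP` (C₁) INSIDE the matching-class core, part 1/2: gadgets and aligned packs (soundness)

Tribunal-w witness, generation 3 (D-0033 T3) for `route-PneNP-Nc03AvoidResidualCore`, item
`stmt-PneNP-20226` (`CandAvoidLinearFP = LocalAvoidLinearFP 3 (IsPure candPred)`), answering the
judge's REGIME caveat on the few-heads rung (`Nc03AvoidResidualCoreCandFewHeadsRung`): that rung's
certificates K1/K3 need an edge surplus inside ONE head class and are VACUOUS on the route's named hard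
family, the MATCHING-CLASS instances (`IsMatchingClass`: two outputs with the same head have disjoint
data pairs — the cell's `CAND^match`, HOME/pnp-ideate-p2/ROUND-3-ADDENDUM-B.md Thm B.1 / Remark B.4),
see `no_certificate_of_isMatchingClass`. Part 2 (`Nc03AvoidResidualCoreCandMatchRung`) proves a rung
living inside that family; this part supplies its certificate.

The GADGET, a universal constant-size contradiction for pure `CAND` (`y_j = x_{c_j} ⊕ (x_{u_j} ∧ x_{v_j})`;
no matching or role-separation hypothesis is needed for soundness): three outputs `(ju, j, jv)` with
`u_j ∈ data(ju)`, `v_j ∈ data(jv)`, `j ∉ {ju, jv}`. The labels `(y_{ju}, y_j, y_{jv}) = (¬α, β, ¬γ)`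
kill every `x` with head values `(x_{c_{ju}}, x_{c_j}, x_{c_{jv}}) = (α, β, γ)`: `y_j = x_{c_j}` forces
`x_{u_j} x_{v_j} = 0`, while `y_{ju} ≠ x_{c_{ju}}` forces both data bits of `ju`, hence `x_{u_j}`, to be
`1`, and likewise `x_{v_j} = 1`. An ALIGNED PACK (`packB`) is eight pairwise output-disjoint gadgets with
a common head signature `(c_u, c, c_v)`, one per pattern `(α, β, γ) ∈ {0,1}³` (`pat`); labelling each by
its pattern and every other output `0` (`packAnswer`) gives a point outside the range
(`packAnswer_not_mem_range`; the degenerate case `ju = jv`, possible when `c_u = c_v`, is handled).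

Also here: the greedy independent-set lemma `exists_indep` (symmetric relation of degree `≤ 2`) used by
part 2 to extract eight disjoint gadgets.

Restricted-model algorithmic rung of the range-avoidance ladder; no bearing on `P` versus `NP`.
-/

set_option linter.dupNamespace false -- `Summit.PneNP.PneNP.…`: summit = sub-problem name (D-0017 single-conjunct layout)

namespace Summit.PneNP.PneNP.Theorems.Nc03AvoidResidualCoreCandMatchRung

open Finset
open Literature.Computability.Complexity
open Summit.PneNP.PneNP.Theorems.Nc03AvoidResidualCoreCandFewHeadsRung

/-! ## A greedy independent-set lemma for symmetric relations of degree at most two -/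

section Indep

variable {α : Type*} [DecidableEq α]

/-- From a finite set carrying a symmetric relation in which every element is related to at most two
others, `t` pairwise unrelated elements can be picked as soon as the set has `≥ 3t − 2` elements
(greedy: pick any element, discard it and its `≤ 2` neighbours, repeat). -/
theorem exists_indep (R : α → α → Bool) (hR : ∀ a b, R a b = true → R b a = true) :
    ∀ (t : ℕ) (S : Finset α), (∀ a ∈ S, #(S.filter fun b => b ≠ a ∧ R a b = true) ≤ 2) →
      3 * t ≤ #S + 2 → ∃ A ⊆ S, #A = t ∧ ∀ a ∈ A, ∀ b ∈ A, a ≠ b → ¬ R a b = true := by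
  intro t
  induction t with
  | zero => intro S _ _; exact ⟨∅, Finset.empty_subset _, rfl, by simp⟩
  | succ t ih =>
    intro S hdeg hcard
    obtain ⟨a, ha⟩ : S.Nonempty := Finset.card_pos.mp (by omega)
    set S' := S.filter fun b => b ≠ a ∧ ¬ R a b = true with hS'
    have hcov : S ⊆ insert a ((S.filter fun b => b ≠ a ∧ R a b = true) ∪ S') := by
      intro b hb
      rw [Finset.mem_insert, Finset.mem_union, Finset.mem_filter, Finset.mem_filter]
      by_cases hba : b = a
      · exact Or.inl hba
      · by_cases hr : R a b = true
        · exact Or.inr (Or.inl ⟨hb, hba, hr⟩)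
        · exact Or.inr (Or.inr ⟨hb, hba, hr⟩)
    have hcard' : 3 * t ≤ #S' + 2 := by
      have h1 := Finset.card_le_card hcov
      have h2 := Finset.card_insert_le a ((S.filter fun b => b ≠ a ∧ R a b = true) ∪ S')
      have h3 := Finset.card_union_le (S.filter fun b => b ≠ a ∧ R a b = true) S'
      have h4 := hdeg a ha
      omega
    have hdeg' : ∀ b ∈ S', #(S'.filter fun c => c ≠ b ∧ R b c = true) ≤ 2 := by
      intro b hb
      have hbS : b ∈ S := (Finset.mem_filter.mp hb).1
      refine le_trans (Finset.card_le_card ?_) (hdeg b hbS)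
      intro c hc
      rw [Finset.mem_filter] at hc ⊢
      exact ⟨(Finset.mem_filter.mp hc.1).1, hc.2⟩
    obtain ⟨A', hA'S', hA'card, hA'⟩ := ih S' hdeg' hcard'
    have haA' : a ∉ A' := fun h => (Finset.mem_filter.mp (hA'S' h)).2.1 rfl
    refine ⟨insert a A', ?_, by rw [Finset.card_insert_of_notMem haA', hA'card], ?_⟩
    · intro b hb
      rw [Finset.mem_insert] at hb
      rcases hb with rfl | hb
      · exact ha
      · exact (Finset.mem_filter.mp (hA'S' hb)).1
    · intro b hb c hc hbc
      rw [Finset.mem_insert] at hb hc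
      rcases hb with rfl | hb <;> rcases hc with rfl | hc
      · exact absurd rfl hbc
      · exact (Finset.mem_filter.mp (hA'S' hc)).2.2
      · exact fun h => (Finset.mem_filter.mp (hA'S' hb)).2.2 (hR _ _ h)
      · exact hA' b hb c hc hbc

end Indep

/-! ## Pure `CAND`: gadgets and aligned packs (soundness) -/

variable {n m : ℕ}

/-- MATCHING CLASSES (the cell's `CAND^match`): two distinct outputs with the same head variable have
disjoint data pairs, i.e. every head class is a matching of the pair graph. -/
def IsMatchingClass (I : LocalMap 3 n m) : Prop :=
  ∀ j j' : Fin m, j ≠ j' → I.vars j 0 = I.vars j' 0 → ∀ a b : Fin 3, a ≠ 0 → b ≠ 0 → I.vars j a ≠ I.vars j' b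

/-- A candidate pack: eight output triples `(ju, j, jv)` (u-flank, middle, v-flank), indexed by
`Fin 8`. -/
abbrev Pack (m : ℕ) := Fin 8 → Fin m × Fin m × Fin m

/-- The head-value pattern `(α, β, γ)` served by gadget `i` of a pack: the three bits of `i`. -/
def pat (i : Fin 8) : Bool × Bool × Bool := (i.val.testBit 2, i.val.testBit 1, i.val.testBit 0)

/-- Every pattern is served. -/
theorem exists_pat : ∀ p : Bool × Bool × Bool, ∃ i : Fin 8, pat i = p := by
  decide

/-- The ALIGNED-PACK test (Boolean, time `poly(n)` per candidate): a common head signature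
`(c_u, c, c_v)`; each middle's data vertices `u_j, v_j` (roles `1, 2`) lie in its u-flank resp.
v-flank; no flank is a middle; and distinct gadgets share no output and have distinct middles. -/
def packB (I : LocalMap 3 n m) (t : Pack m) : Bool :=
  decide ((∀ i, I.vars (t i).2.1 0 = I.vars (t 0).2.1 0) ∧ (∀ i, I.vars (t i).1 0 = I.vars (t 0).1 0) ∧
    (∀ i, I.vars (t i).2.2 0 = I.vars (t 0).2.2 0) ∧
    (∀ i, I.vars (t i).2.1 1 ∈ pset I (t i).1) ∧ (∀ i, I.vars (t i).2.1 2 ∈ pset I (t i).2.2) ∧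
    (∀ i i', (t i).1 ≠ (t i').2.1) ∧ (∀ i i', (t i).2.2 ≠ (t i').2.1) ∧
    (∀ i i', i ≠ i' →
      (t i).2.1 ≠ (t i').2.1 ∧ (t i).1 ≠ (t i').1 ∧ (t i).1 ≠ (t i').2.2 ∧ (t i).2.2 ≠ (t i').2.2))

/-- The CERTIFICATE ANSWER of a pack: middle `i ↦ β_i`, u-flank `i ↦ ¬α_i`, v-flank `i ↦ ¬γ_i`
(in this priority; a v-flank equal to its own u-flank keeps `¬α_i`), every other output `↦ 0`. -/
def packAnswer (t : Pack m) (o : Fin m) : Bool :=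
  ((List.finRange 8).find? fun i => decide ((t i).2.1 = o)).elim
    (((List.finRange 8).find? fun i => decide ((t i).1 = o)).elim
      (((List.finRange 8).find? fun i => decide ((t i).2.2 = o)).elim false fun i => !(pat i).2.2)
      fun i => !(pat i).1)
    fun i => (pat i).2.1

/-- A search over the eight indices finds the unique index with a given value. -/
theorem find?_fin8_eq {g : Fin 8 → Fin m} {i : Fin 8} (h : ∀ i', g i' = g i → i' = i) :
    (List.finRange 8).find? (fun i' => decide (g i' = g i)) = some i := by
  cases hf : (List.finRange 8).find? (fun i' => decide (g i' = g i)) with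
  | none => exact absurd (by simp) (List.find?_eq_none.mp hf i (List.mem_finRange i))
  | some i' =>
    have hi' := List.find?_some hf
    simp only [decide_eq_true_eq] at hi'
    rw [h i' hi']

/-- A search over the eight indices for an absent value fails. -/
theorem find?_fin8_none {g : Fin 8 → Fin m} {o : Fin m} (h : ∀ i', g i' ≠ o) :
    (List.finRange 8).find? (fun i' => decide (g i' = o)) = none := by
  rw [List.find?_eq_none]
  intro i' _
  simpa using h i'

/-- The answer on a middle is its `β`. -/
theorem packAnswer_mid {t : Pack m} (hmm : ∀ i i', i ≠ i' → (t i).2.1 ≠ (t i').2.1) (i : Fin 8) :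
    packAnswer t (t i).2.1 = (pat i).2.1 := by
  have h1 := find?_fin8_eq (g := fun i' => (t i').2.1) (i := i) fun i' hi' => by
    by_contra hne; exact hmm i' i hne hi'
  simp only [packAnswer, h1, Option.elim]

/-- The answer on a u-flank is its `¬α`. -/
theorem packAnswer_ufl {t : Pack m} (hum : ∀ i i', (t i).1 ≠ (t i').2.1)
    (huu : ∀ i i', i ≠ i' → (t i).1 ≠ (t i').1) (i : Fin 8) : packAnswer t (t i).1 = !(pat i).1 := by
  have h1 := find?_fin8_none (g := fun i' => (t i').2.1) (o := (t i).1) fun i' => (hum i i').symm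
  have h2 := find?_fin8_eq (g := fun i' => (t i').1) (i := i) fun i' hi' => by
    by_contra hne; exact huu i' i hne hi'
  simp only [packAnswer, h1, h2, Option.elim]

/-- The answer on a v-flank is its `¬γ` — unless the v-flank is the gadget's own u-flank (degenerate
gadget), where it is `¬α`. -/
theorem packAnswer_vfl {t : Pack m} (hvm : ∀ i i', (t i).2.2 ≠ (t i').2.1)
    (huv : ∀ i i', i ≠ i' → (t i).1 ≠ (t i').2.2) (hvv : ∀ i i', i ≠ i' → (t i).2.2 ≠ (t i').2.2)
    (i : Fin 8) :
    packAnswer t (t i).2.2 = !(pat i).2.2 ∨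
      ((t i).1 = (t i).2.2 ∧ packAnswer t (t i).2.2 = !(pat i).1) := by
  have h1 := find?_fin8_none (g := fun i' => (t i').2.1) (o := (t i).2.2) fun i' => (hvm i i').symm
  by_cases hdeg : (t i).1 = (t i).2.2
  · right
    refine ⟨hdeg, ?_⟩
    have h2 : (List.finRange 8).find? (fun i' => decide ((t i').1 = (t i).2.2)) = some i := by
      rw [← hdeg]
      exact find?_fin8_eq (g := fun i' => (t i').1) fun i' hi' => by
        by_contra hne; exact huv i' i hne (hi'.trans hdeg)
    simp only [packAnswer, h1, h2, Option.elim]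
  · left
    have h2 := find?_fin8_none (g := fun i' => (t i').1) (o := (t i).2.2) fun i' hi' => by
      by_cases hii : i' = i
      · subst hii; exact hdeg hi'
      · exact huv i' i hii hi'
    have h3 := find?_fin8_eq (g := fun i' => (t i').2.2) (i := i) fun i' hi' => by
      by_contra hne; exact hvv i' i hne hi'
    simp only [packAnswer, h1, h2, h3, Option.elim]

/-- `β ⊕ W = β` forces `W = 0`. -/
theorem eq_false_of_xor_eq_self {B W : Bool} (h : xor B W = B) : W = false := by
  revert B W; decide

/-- `α ⊕ P = ¬α` forces `P = 1`. -/
theorem eq_true_of_xor_eq_not {A P : Bool} (h : xor A P = !A) : P = true := by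
  revert A P; decide

/-- If the `AND` of an output's data pair is `1`, every vertex of the pair is `1`. -/
theorem true_of_mem_pset {I : LocalMap 3 n m} {j : Fin m} {w : Fin n} {x : Fin n → Bool}
    (hw : w ∈ pset I j) (h : (x (I.vars j 1) && x (I.vars j 2)) = true) : x w = true := by
  rw [Bool.and_eq_true] at h
  rw [pset, Finset.mem_insert, Finset.mem_singleton] at hw
  rcases hw with rfl | rfl
  · exact h.1
  · exact h.2

/-- **Soundness of aligned packs.** On a pure `CAND` instance the certificate answer of a pack passing
the test lies outside the range: the gadget serving the realised head pattern `(x_{c_u}, x_c, x_{c_v})`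
is violated. -/
theorem packAnswer_not_mem_range {I : LocalMap 3 n m} (hI : I.IsPure candPred) {t : Pack m}
    (ht : packB I t = true) : packAnswer t ∉ I.range := by
  simp only [packB, decide_eq_true_eq] at ht
  obtain ⟨hc, hcu, hcv, hu, hv, hum, hvm, hx⟩ := ht
  rintro ⟨x, hxy⟩
  obtain ⟨i, hi⟩ :=
    exists_pat (x (I.vars (t 0).1 0), x (I.vars (t 0).2.1 0), x (I.vars (t 0).2.2 0))
  have hmid : packAnswer t (t i).2.1 = (pat i).2.1 := packAnswer_mid (fun a b hab => (hx a b hab).1) i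
  have huf : packAnswer t (t i).1 = !(pat i).1 :=
    packAnswer_ufl hum (fun a b hab => (hx a b hab).2.1) i
  have hvf := packAnswer_vfl hvm (fun a b hab => (hx a b hab).2.2.1) (fun a b hab => (hx a b hab).2.2.2) i
  have em := congrFun hxy (t i).2.1
  have eu := congrFun hxy (t i).1
  have ev := congrFun hxy (t i).2.2
  rw [eval_eq hI, hc i, hmid, hi] at em
  rw [eval_eq hI, hcu i, huf, hi] at eu
  have hUV : (x (I.vars (t i).2.1 1) && x (I.vars (t i).2.1 2)) = false := eq_false_of_xor_eq_self em
  have hP : (x (I.vars (t i).1 1) && x (I.vars (t i).1 2)) = true := eq_true_of_xor_eq_not eu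
  have hU : x (I.vars (t i).2.1 1) = true := true_of_mem_pset (hu i) hP
  have hV : x (I.vars (t i).2.1 2) = true := by
    rcases hvf with hvf | ⟨hdeg, -⟩
    · rw [eval_eq hI, hcv i, hvf, hi] at ev
      exact true_of_mem_pset (hv i) (eq_true_of_xor_eq_not ev)
    · have hv' : I.vars (t i).2.1 2 ∈ pset I (t i).1 := by rw [hdeg]; exact hv i
      exact true_of_mem_pset hv' hP
  rw [hU, hV] at hUV
  exact Bool.noConfusion hUV

/-! ## Matching-class instances: the few-heads certificates are vacuous -/

/-- In a matching-class instance an output is determined by its head and any one of its data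
vertices. -/
theorem eq_of_mem_pset {I : LocalMap 3 n m} (hM : IsMatchingClass I) {j j' : Fin m}
    (hh : I.vars j 0 = I.vars j' 0) {w : Fin n} (hw : w ∈ pset I j) (hw' : w ∈ pset I j') : j = j' := by
  by_contra hne
  rw [pset, Finset.mem_insert, Finset.mem_singleton] at hw hw'
  rcases hw with rfl | rfl <;> rcases hw' with h | h
  · exact hM j j' hne hh 1 1 (by decide) (by decide) h
  · exact hM j j' hne hh 1 2 (by decide) (by decide) h
  · exact hM j j' hne hh 2 1 (by decide) (by decide) h
  · exact hM j j' hne hh 2 2 (by decide) (by decide) h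

/-- **The few-heads rung is vacuous on the matching-class family**: a matching-class instance has
neither a K1 (parallel pair) nor a K3 (path motif) certificate of
`Nc03AvoidResidualCoreCandFewHeadsRung` — both need two outputs of one head class sharing a data
vertex. (This is the judge's REGIME caveat, made precise.) -/
theorem no_certificate_of_isMatchingClass {I : LocalMap 3 n m} (hM : IsMatchingClass I) :
    (∀ p, parallelB I p = false) ∧ ∀ q, motifB I q = false := by
  constructor
  · intro p
    rw [← Bool.not_eq_true]
    intro h
    simp only [parallelB, decide_eq_true_eq] at h
    obtain ⟨hne, hh, hp⟩ := h
    have hu : I.vars p.1 1 ∈ pset I p.2 := by rw [← hp]; simp [pset]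
    exact hne (eq_of_mem_pset hM hh (by simp [pset]) hu)
  · intro q
    rw [← Bool.not_eq_true]
    intro h
    simp only [motifB, decide_eq_true_eq] at h
    obtain ⟨h2, -, -, n21, -, -, -, a, -, b, -, c, -, d, -, f, -, p1, p2, -, -⟩ := h
    have hb1 : b ∈ pset I q.1.1 := by rw [p1]; simp
    have hb2 : b ∈ pset I q.1.2 := by rw [p2]; simp
    exact n21 (eq_of_mem_pset hM h2 hb2 hb1)


end Summit.PneNP.PneNP.Theorems.Nc03AvoidResidualCoreCandMatchRung
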